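import Literature.NumberTheory.Automorphic.AutomorphicRepsGL
import HarnessLib

/-!
# The inversion bridge for cuspidality on `GL_n(𝔸_K)`: proof of the named fact
`cuspConditionGL_invQuot_iff`

Topic `NumberTheory/Automorphic`; sibling proof file of
`Literature.NumberTheory.Automorphic.AutomorphicRepsGL` (D-0014 discharge, no new definitions).

`AutomorphicRepsGL` states two cusp conditions along the standard maximal parabolic `P_k` of
`GL_n`, both quantified over **all** additive Haar measures `ν` on `𝔫_k(𝔸_K)` and **all**
measurable fundamental domains `𝓕` of the translation action of `𝔫_k(K)`:

* `CuspConditionGL n K φ k` (Borel–Jacquet convention, left `G(K)`-invariant `φ` on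
  `GL_n(𝔸_K)`, unipotent variable on the left): `∫_𝓕 φ ((1 + X) g) dν(X) = 0` for all `g`;
* `ConstantTermVanishes n K f k` (G19 convention, `f` on the left-coset space
  `GL_n(𝔸_K) ⧸ A_G GL_n(K)`, unipotent variable on the right): `∫_𝓕 f [x (1 + X)] dν(X) = 0`
  for all `x`;

each together with integrability of the integrand on `𝓕`. The named fact
`AutomorphicRepsGL.cuspConditionGL_invQuot_iff n K` asserts that the inversion dictionary
`invQuot f = (g ↦ f [g⁻¹])` exchanges them. This file proves it
(`AutomorphicRepsGL.cuspConditionGL_invQuot_iff_holds`).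

## Proof

`invQuot f ((1 + X) g) = f [g⁻¹ (1 + X)⁻¹] = f [g⁻¹ (1 - X)]` since `X ↦ 1 + X` is a homomorphism
on `Multiplicative 𝔫_k` (`glUnipotent`, `𝔫_k² = 0`). Negation `X ↦ -X` is a measurable (indeed
continuous additive) involution of `𝔫_k(𝔸_K)`, so it maps an additive Haar measure `ν` to the
additive Haar measure `ν.map Neg.neg` (Mathlib `AddEquiv.isAddHaarMeasure_map` for
`AddEquiv.neg`), a fundamental domain `𝓕` of `𝔫_k(K)` to the fundamental domain `-𝓕` for
`ν.map Neg.neg` (Mathlib `IsAddFundamentalDomain.preimage_of_equiv`, the compatible automorphism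
of `𝔫_k(K)` being `γ ↦ -γ`), and transports integrability and set integrals (Mathlib
`MeasurableEmbedding.integrableOn_map_iff`, `MeasurableEmbedding.setIntegral_map`):
`AutomorphicRepsGL.negTransfer_blockNilpotent`. Since both conditions quantify over all pairs
`(ν, 𝓕)`, each follows from the other applied to `(ν.map Neg.neg, -𝓕)` at the inverse group
element. No invariance `ν.map Neg.neg = ν` (true, but needing Haar uniqueness on the locally
compact group `𝔫_k(𝔸_K)`) is used.

## References

* A. Borel, H. Jacquet, *Automorphic forms and automorphic representations*, Proc. Sympos. Pure
  Math. 33 (Corvallis 1979), part 1, §4.4 (cusp forms: the constant terms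
  `∫_{N(K) \ N(𝔸)} φ (n g) dn` along the unipotent radicals of the proper parabolic
  `K`-subgroups vanish).
* D. Bump, *Automorphic Forms and Representations* (1997), §3.3, Eq. (3.7) (the same condition
  for `GL_n`, block unipotents `(I_r X; 0 I_s)` on the left of `g`).
-/

open scoped MatrixGroups
open NumberField IsDedekindDomain
open _root_.MeasureTheory

noncomputable section

namespace Literature.NumberTheory.Automorphic

variable {n : ℕ} {K : Type} [Field K] [NumberField K]

/-- **Transfer along `X ↦ -X` on `𝔫_k(𝔸_K)`.** For an additive Haar measure `ν` on `𝔫_k(𝔸_K)`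
and a fundamental domain `𝓕` of the translation action of `𝔫_k(K)`: `ν.map Neg.neg` is an
additive Haar measure, `-𝓕 = Neg.neg ⁻¹' 𝓕` is a fundamental domain of `𝔫_k(K)` for it, and
integrability on / the integral over `-𝓕` against `ν.map Neg.neg` of any `φ` are those of
`X ↦ φ (-X)` over `𝓕` against `ν` (change of variables along the measurable involution
`Neg.neg`; Mathlib `AddEquiv.isAddHaarMeasure_map`, `IsAddFundamentalDomain.preimage_of_equiv`,
`MeasurableEmbedding.integrableOn_map_iff`, `MeasurableEmbedding.setIntegral_map`). [folklore] -/
theorem AutomorphicRepsGL.negTransfer_blockNilpotent {k : ℕ}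
    (ν : Measure (blockNilpotent n k (AdeleRing (𝓞 K) K))) [ν.IsAddHaarMeasure]
    {𝓕 : Set (blockNilpotent n k (AdeleRing (𝓞 K) K))}
    (h𝓕 : IsAddFundamentalDomain (rationalBlock n k K) 𝓕 ν) :
    (ν.map Neg.neg).IsAddHaarMeasure ∧
      IsAddFundamentalDomain (rationalBlock n k K) (Neg.neg ⁻¹' 𝓕) (ν.map Neg.neg) ∧
        ∀ φ : blockNilpotent n k (AdeleRing (𝓞 K) K) → ℂ,
          (IntegrableOn φ (Neg.neg ⁻¹' 𝓕) (ν.map Neg.neg) ↔ IntegrableOn (fun X ↦ φ (-X)) 𝓕 ν) ∧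
            ∫ X in Neg.neg ⁻¹' 𝓕, φ X ∂(ν.map Neg.neg) = ∫ X in 𝓕, φ (-X) ∂ν := by
  have hme : MeasurableEmbedding (Neg.neg : blockNilpotent n k (AdeleRing (𝓞 K) K) →
      blockNilpotent n k (AdeleRing (𝓞 K) K)) :=
    (MeasurableEquiv.neg (blockNilpotent n k (AdeleRing (𝓞 K) K))).measurableEmbedding
  have hpre : Neg.neg ⁻¹' (Neg.neg ⁻¹' 𝓕) = 𝓕 := by
    ext X
    simp only [Set.mem_preimage, neg_neg]
  refine ⟨?_, ?_, fun φ ↦ ⟨?_, ?_⟩⟩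
  · exact (AddEquiv.neg (blockNilpotent n k (AdeleRing (𝓞 K) K))).isAddHaarMeasure_map ν
      continuous_neg continuous_neg
  · refine h𝓕.preimage_of_equiv
      ((MeasurableEquiv.neg (blockNilpotent n k (AdeleRing (𝓞 K) K))).quasiMeasurePreserving_symm ν)
      (e := fun γ ↦ -γ) neg_involutive.bijective fun γ X ↦ ?_
    simp only [AddSubgroup.vadd_def, vadd_eq_add, AddSubgroup.coe_neg, neg_add, neg_neg]
  · rw [hme.integrableOn_map_iff, hpre]
    rfl
  · rw [hme.setIntegral_map, hpre]

variable (n K) in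
/-- **Discharge of the named fact `AutomorphicRepsGL.cuspConditionGL_invQuot_iff`** (the D2
inversion bridge for cuspidality): for `f` on G19's quotient `GL_n(𝔸_K) ⧸ A_G GL_n(K)`, the
left-invariant function `invQuot f = (g ↦ f [g⁻¹])` satisfies the (left) cusp condition
`CuspConditionGL` along `P_k` iff `f` has vanishing `k`-th constant terms in G19's (right) sense
`ConstantTermVanishes`. Proof: `invQuot f ((1 + X) g) = f [g⁻¹ (1 - X)]`, and each side is the
other applied to the additive Haar measure `ν.map Neg.neg`, the fundamental domain `-𝓕` and the
inverse group element (`AutomorphicRepsGL.negTransfer_blockNilpotent`). The cusp condition is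
that of Borel–Jacquet 1979, 4.4 (left `G(K)`-invariant forms, `∫_{N(K) \ N(𝔸)} φ (n g) dn = 0`);
the same left convention for `GL_n` is Bump 1997, §3.3, Eq. (3.7). [cite: BorelJacquet1979, 4.4] -/
theorem AutomorphicRepsGL.cuspConditionGL_invQuot_iff_holds :
    AutomorphicRepsGL.cuspConditionGL_invQuot_iff n K := by
  intro f k
  have key : ∀ (g : (AdelicGroupData.gl n K).Adelic) (X : blockNilpotent n k (AdeleRing (𝓞 K) K)),
      invQuot (AdelicGroupData.gl n K) f (glUnipotent n k K (Multiplicative.ofAdd X) * g) =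
        f ((AdelicGroupData.gl n K).toAutomorphicQuotient
          (g⁻¹ * glUnipotent n k K (Multiplicative.ofAdd (-X)))) := by
    intro g X
    rw [invQuot_apply, mul_inv_rev, ofAdd_neg, map_inv]
  constructor
  · intro h ν _ 𝓕 h𝓕 x
    obtain ⟨hν', h𝓕', htr⟩ := AutomorphicRepsGL.negTransfer_blockNilpotent ν h𝓕
    obtain ⟨hi, h0⟩ := @h (ν.map Neg.neg) hν' (Neg.neg ⁻¹' 𝓕) h𝓕' x⁻¹
    obtain ⟨hiff, hint⟩ := htr fun X ↦ f ((AdelicGroupData.gl n K).toAutomorphicQuotient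
      (x * glUnipotent n k K (Multiplicative.ofAdd (-X))))
    simp only [key, inv_inv] at hi h0
    simp only [neg_neg] at hiff hint
    exact ⟨hiff.mp hi, hint ▸ h0⟩
  · intro h ν _ 𝓕 h𝓕 g
    obtain ⟨hν', h𝓕', htr⟩ := AutomorphicRepsGL.negTransfer_blockNilpotent ν h𝓕
    obtain ⟨hi, h0⟩ := @h (ν.map Neg.neg) hν' (Neg.neg ⁻¹' 𝓕) h𝓕' g⁻¹
    obtain ⟨hiff, hint⟩ := htr fun X ↦ f ((AdelicGroupData.gl n K).toAutomorphicQuotient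
      (g⁻¹ * glUnipotent n k K (Multiplicative.ofAdd X)))
    simp only [key]
    exact ⟨hiff.mp hi, hint ▸ h0⟩

end Literature.NumberTheory.Automorphic
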